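import Summits.RiemannHypothesis.RiemannHypothesis.Theses.RuelleBand
import Literature.Barriers.RiemannHypothesis.DavenportHeilbronnProofs

/-!
# `CofiniteCriticalLine` (crux stmt-RiemannHypothesis-2064) — natural abstractions refuted by small models

The crux of route RuelleBand, rank 5, is
`CofiniteCriticalLine := {s : ℂ | riemannZeta s = 0 ∧ 0 < s.re ∧ s.re < 1 ∧ s.re ≠ 1 / 2}.Finite`.
Refuter's standing-adversary output (cdisprove cycle 1): three kernel-checked negative facts about the
SHAPE of the statement (no new definitions).

* `not_abstract_asymptotic_imp_cofinite` — rung #4's shape (`AsymptoticCriticalLine`: for every `ε > 0` only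
  finitely many points with `|re s - 1/2| ≥ ε`) does NOT imply rung #5's shape (finitely many points off the
  line) for an abstract set: witness `Z = {1/2 + 1/(n+2) + n i : n ∈ ℕ}`. The step #4 ⇒ #5 needs arithmetic.
* `not_abstract_cofinite_imp_exact` — rung #5's shape does NOT imply the shape of thesis X (`ExactFirstBand`:
  on the line or real): witness the single point `3/4 + i`. "Exceptional zeros are real" is genuine input.
* `not_cofinite_shape_davenportHeilbronn` — BARRIER: in the `ζ`-equivalent form with the (for `ζ` redundant)
  window `re s < 1` dropped, the statement is FALSE for the Davenport–Heilbronn function, which has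
  infinitely many zeros in `re s > 1` (Davenport–Heilbronn 1936, Titchmarsh §10.25; PROVED in tree,
  `Literature.Barriers.RiemannHypothesis.DavenportHeilbronn_holds`). A proof of the crux must use a property of
  `ζ` beyond "Dirichlet series + degree-one functional equation" (the Euler product).
-/

noncomputable section

open Complex Set

namespace Summit.RiemannHypothesis.Cruxes.CofiniteCriticalLine.Negative

/-- Rung #4's SHAPE does not imply rung #5's shape for an abstract set `Z ⊆ ℂ`:
`Z = {1/2 + 1/(n+2) + n i}` meets every closed band `|re s - 1/2| ≥ ε > 0` in finitely many points, yet
all of its infinitely many points are off the line `re s = 1/2`. [folklore] -/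
theorem not_abstract_asymptotic_imp_cofinite :
    ¬ ∀ Z : Set ℂ, (∀ ε : ℝ, 0 < ε → {s ∈ Z | ε ≤ |s.re - 1 / 2|}.Finite) →
      {s ∈ Z | s.re ≠ 1 / 2}.Finite := by
  intro h
  let f : ℕ → ℂ := fun n => ((1 / 2 + 1 / ((n : ℝ) + 2) : ℝ) : ℂ) + (n : ℂ) * I
  have hf_re : ∀ n, (f n).re = 1 / 2 + 1 / ((n : ℝ) + 2) := by
    intro n
    simp only [f, add_re, ofReal_re, mul_re, natCast_re, natCast_im, I_re, I_im, mul_zero, zero_mul,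
      sub_zero, add_zero]
  have hf_im : ∀ n, (f n).im = n := by
    intro n
    simp only [f, add_im, ofReal_im, mul_im, natCast_re, natCast_im, I_re, I_im, mul_one, mul_zero,
      add_zero, zero_add]
  have hf : Function.Injective f := by
    intro a b hab
    have := congrArg Complex.im hab
    rw [hf_im, hf_im] at this
    exact_mod_cast this
  have hpos : ∀ n : ℕ, (0 : ℝ) < 1 / ((n : ℝ) + 2) := fun n => by positivity
  have hband : ∀ ε : ℝ, 0 < ε → {s ∈ Set.range f | ε ≤ |s.re - 1 / 2|}.Finite := by
    intro ε hε
    refine ((Set.finite_Iic ⌈1 / ε⌉₊).image f).subset ?_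
    rintro s ⟨⟨n, rfl⟩, hs⟩
    refine ⟨n, ?_, rfl⟩
    rw [hf_re, add_sub_cancel_left, abs_of_pos (hpos n)] at hs
    show n ≤ ⌈1 / ε⌉₊
    have hn2 : (0 : ℝ) < (n : ℝ) + 2 := by positivity
    have h1 : ε * ((n : ℝ) + 2) ≤ 1 := by
      have := (le_div_iff₀ hn2).1 hs
      linarith
    have h2 : (n : ℝ) + 2 ≤ 1 / ε := by
      rw [le_div_iff₀ hε]; linarith
    have h3 : (n : ℝ) ≤ ⌈1 / ε⌉₊ := by linarith [Nat.le_ceil (1 / ε)]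
    exact_mod_cast h3
  have hfin := h (Set.range f) hband
  refine (Set.infinite_range_of_injective hf) (hfin.subset ?_)
  rintro s ⟨n, rfl⟩
  refine ⟨⟨n, rfl⟩, ?_⟩
  show (f n).re ≠ 1 / 2
  rw [hf_re]
  exact ne_of_gt (by linarith [hpos n])

/-- Rung #5's shape does not imply thesis X's shape ("on the line or real") for an abstract set: the single
non-real off-line point `3/4 + i`. [folklore] -/
theorem not_abstract_cofinite_imp_exact :
    ¬ ∀ Z : Set ℂ, {s ∈ Z | s.re ≠ 1 / 2}.Finite → ∀ s ∈ Z, s.re = 1 / 2 ∨ s.im = 0 := by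
  intro h
  have hZ : {s ∈ ({((3 / 4 : ℝ) : ℂ) + I} : Set ℂ) | s.re ≠ 1 / 2}.Finite :=
    (Set.finite_singleton _).subset (Set.sep_subset _ _)
  have := h {((3 / 4 : ℝ) : ℂ) + I} hZ (((3 / 4 : ℝ) : ℂ) + I) rfl
  norm_num at this

open Literature.Barriers.RiemannHypothesis in
/-- BARRIER (functional-equation-only arguments): the crux in the form `{L = 0 ∧ 0 < re s ∧ re s ≠ 1/2}.Finite`
(equivalent to `CofiniteCriticalLine` for `L = ζ`, which has no zeros on `re s ≥ 1`) is FALSE for the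
Davenport–Heilbronn function `L = f`: `f` has infinitely many zeros with `re s > 1` (proved in tree,
`DavenportHeilbronn_holds`). [cite: Titchmarsh1986, §10.25] -/
theorem not_cofinite_shape_davenportHeilbronn :
    ¬ {s : ℂ | davenportHeilbronn s = 0 ∧ 0 < s.re ∧ s.re ≠ 1 / 2}.Finite := by
  intro hfin
  refine DavenportHeilbronn_holds (hfin.subset ?_)
  rintro s ⟨h1, hz⟩
  exact ⟨hz, by linarith, fun h => by rw [h] at h1; norm_num at h1⟩

end Summit.RiemannHypothesis.Cruxes.CofiniteCriticalLine.Negative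

end
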